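import Summits.QuantumFields.BalabanUV.Beta.D1BFx.NeedleNdlDipEnvelope
import Summits.QuantumFields.BalabanUV.Beta.D1BFx.GluonNdlLocalRow

/-!
# `BalabanUV.Beta.D1BFx.NeedleNdlDipRow` — road «BF-x» for binder row D1, slot (K), END row `hGrp gN`, «GN-33 ∕ NK»: THE `ndlPiece ⊗ dipPiece` CELL OF
# THE GLUON NEEDLE ROW T₃ IS n-UNIFORM UNDER THE RAY WEIGHT — `|cK n · cellSum n a (ndlPiece n a (cQ n)) (dipPiece n a) μ ν| ≤ C` for every `n ≥ 1`,
# the hypothesis `hnd` of `GluonNeedleGlue.h₃_of_cells`, modulo [B5, Prop. 1.2] ∧ [B5, (1.126)–(1.127)] BY NAME and the displayed ray pins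
# `|cK n| ≤ cgh·n²`, `|cQ n| ≤ cQ₀`

HONEST DEPENDENCY (cell records, verbatim): «continuum YM on T⁴ ⇐ BetaPertH ∧ nine spine estimates (0/9 proved); BetaPertH ⇐ (D1) ∧ (D4) ∧
CAP+tail; G-an2-4 gates asym, D1 and NE2/3/4.»  HONEST FRAMING (cell contract, verbatim): «discharging `BetaPertH` makes Bałaban's UV stability
UNCONDITIONAL — a real constructive-QFT result; it is NOT the continuum limit and NOT the Clay problem.»  THIS MODULE DISCHARGES NOTHING of the
wall: [folklore] counting over `NeedleNdlDipEnvelope.exists_word_envelope` (where the two NAMED printed statements enter, BY NAME, through the letters),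
gan24-leaf-05-g41's bond marginal M7 `NeedleBondMarginal.sum_bond_abs_qJet_le`, my `GluonNdlLocalRow.abs_weight_le_of_same_block` ∕ `sum_moment_prof_le`,
the owner's `NeedleProjProjRow.sum_resSite_avg_le` ∕ `GluonNeedleGlue.cellSum_def`, `B6QGQLower276` (`U`, `sum_U`, `subset_U_image`),
`LatticeHLSPairing.abs_fullSum_le_of_abs_sum_le`.  No `def`, no `def … : Prop`, nothing cited, 0 sorry.  Root-level binders hW ∕ hR-sockets ∕ hSX-socket ∕
D1Tel ∕ D1Rep — 0 discharged; (K) NOT closed; NOT D1, NOT `BetaPertH`, NOT continuum, NOT Clay.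

ABSOLUTE RULE (cell charter, verbatim): «No internally-minted statement may enter as a cited fact. Every hypothesis is either kernel-proved in
this package or a verbatim quotation of a PUBLISHED theorem with page reference. The manuscript(s) under audit are NOT citable for their own
disputed steps — they are the thing under adjudication; programme-internal (2001/route/tribunal) claims are never citable.»

WHY (owner d1-p2 gen 11 RULING ρ-g11-2 ∕ ρ-g11-3 «NK∕KN shapes = `hnd`∕`hdn` of `h₃_of_cells` with `(hcK : ∀ n, |cK n| ≤ cgh·n²)` + `(hcQ : ∀ n, |cQ n| ≤ cQ₀)`»;
my statement line l.31599).  COUNT.  The word at `(b, w)`, needle bond `u = b + w`: `≤ Σ_{s∈B(blk u)} |qJet_u s|·g(s)`,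
`g = A₁n⁻⁴·e₄(b−s)∕nrm(b−s) + A₀n⁻⁵·e₄(b−s)`; the census at the w-sum by the block-by-block exchange (as for T₂-Q̇): `Σ_{u∈B β}|w_μw_ν|·|qJet_u s|
≤ (2‖b−s‖²+2n²)·(n−1)n⁻⁴` (M7 with `(β,s)` fixed), then the centred damped moments `Σ_s(2‖b−s‖²+2n²)·e₄∕nrm ~ n⁵`, `Σ_s(…)·e₄ ~ n⁶`
⇒ `|fullSum_b| ≤ (n−1)n⁻⁴·(A₁n⁻⁴·M₁n⁵ + A₀n⁻⁵·M₀n⁶) ≤ K·n⁻²` uniformly in `b`; base average convex; `× |cK n| ≤ cgh·n²` ⇒ n⁰.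
* §1 [folklore] **`abs_fullSum_le_of_needle_envelope`** (generic: a needle-site envelope at the running bond + centred weighted moments ⇒ the (1.22) sum).
* §2 [folklore] **`exists_ndlDip_row_le`** = `hnd` of `GluonNeedleGlue.h₃_of_cells` for every `n ≥ 1` (the `2 ≤ n` form a fortiori).
NOT HERE (honest): the mirror cell `dip ⊗ ndl` (`NeedleDipNdlRow`, needle at the base bond).
Unit `b2b-balaban-beta-d1-formalise-leaf-01` (gen 15), D1 formalisation swarm LEAF PROVER 01; `LEAVES-BFx.md` row (N) «GN-33∕NK».
-/

noncomputable section

namespace Summit.QuantumFields.BalabanUV.Beta.D1BFx.NeedleNdlDipRow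

open Finset
open scoped BigOperators
open Literature.MathematicalPhysics.QuantumFieldTheory.Balaban1983to89
open Literature.MathematicalPhysics.QuantumFieldTheory.Balaban1983to89.Beta
open B6QGQLower276 (X e blk B mem_B U sum_U subset_U_image)
open ExpKernelCalculus (Site MKer)
open DyadicShell (Pt toReal)
open WindowIdentification (fullSum)
open DressedMomentNormalisation (resSite)
open VectorTailsLoc (fam kfam)
open Beta.PoissonInterior (nrm nrm_pos nrm_neg)
open Summit.QuantumFields.BalabanUV.Beta.D1BFx.FineHessianSectors (biBubbleTable)
open Summit.QuantumFields.BalabanUV.Beta.D1BFx.GluonLeg (Ga)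
open Summit.QuantumFields.BalabanUV.Beta.D1BFx.FrozenLegTails (nOf MOf hn1)
open Summit.QuantumFields.BalabanUV.Beta.D1BFx.GhostStencil (qJet)
open Summit.QuantumFields.BalabanUV.Beta.D1BFx.GluonNeedleSplit (ndlPiece dipPiece)
open Summit.QuantumFields.BalabanUV.Beta.D1BFx.GluonNeedleGlue (cellSum cellSum_def)
open Summit.QuantumFields.BalabanUV.Beta.D1BFx.NeedleProjProjRow (sum_resSite_avg_le)
open Summit.QuantumFields.BalabanUV.Beta.D1BFx.LatticeHLSPairing (abs_fullSum_le_of_abs_sum_le)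
open Summit.QuantumFields.BalabanUV.Beta.D1BFx.GluonNdlLocalRow (abs_weight_le_of_same_block sum_moment_prof_le)
open Summit.QuantumFields.BalabanUV.Beta.D1BFx.NeedleNdlDipEnvelope (exists_word_envelope)

variable (n : ℕ) [NeZero n] (a : ℝ)

/-! ## §1 The (1.22) sum at one base site from a needle-site envelope at the running bond -/

/-- [folklore] **THE (1.22) SUM FROM A NEEDLE-SITE ENVELOPE AT THE RUNNING BOND** (generic): if `|T w| ≤ Σ_{s∈B(blk(b+w))} |qJet_{b+w} s|·g(s)` with `g ≥ 0`
and the centred weighted moments are bounded, `Σ_{s∈S}(2‖b−s‖²+2n²)·g(s) ≤ Mg` for every finite `S`, then `|fullSum (w ↦ w_μw_ν·T w)| ≤ (n−1)n⁻⁴·Mg`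
(block-by-block exchange `subset_U_image` ∕ `sum_U`, the weight `|(u−b)_μ(u−b)_ν| ≤ 2‖b−s‖²+2n²` for `u, s` in one block, M7 at `(β, s)` fixed). -/
theorem abs_fullSum_le_of_needle_envelope {T g : Pt → ℝ} {Mg : ℝ} (κ : Fin 4) (b : Pt) (hg0 : ∀ s, 0 ≤ g s)
    (hT : ∀ w : Pt, |T w| ≤ ∑ s ∈ B (n - 1) (blk (n - 1) (b + w)), |qJet n κ (b + w) (blk (n - 1) (b + w)) s| * g s)
    (hmom : ∀ S : Finset Pt, ∑ s ∈ S, (2 * (PoissonInterior.supNorm (d := 4) (b - s) : ℝ) ^ 2 + 2 * (n : ℝ) ^ 2) * g s ≤ Mg) (μ ν : Fin 4) :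
    |fullSum (fun w : Pt => toReal w μ * toReal w ν * T w)| ≤ (((n : ℝ) - 1) * ((n : ℝ) ^ 4)⁻¹) * Mg := by
  classical
  have hn1 : (1 : ℝ) ≤ n := by exact_mod_cast NeZero.one_le
  set m : ℕ := n - 1 with hm
  set h : Pt → ℝ := fun u => |toReal (u - b) μ * toReal (u - b) ν| * ∑ s ∈ B m (blk m u), |qJet n κ u (blk m u) s| * g s with hh
  have hh0 : ∀ u, 0 ≤ h u := fun u => mul_nonneg (abs_nonneg _) (Finset.sum_nonneg fun s _ => mul_nonneg (abs_nonneg _) (hg0 s))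
  have hdom : ∀ w : Pt, |toReal w μ * toReal w ν * T w| ≤ h (b + w) := by
    intro w
    rw [abs_mul, hh]
    simp only [add_sub_cancel_left]
    exact mul_le_mul_of_nonneg_left (hT w) (abs_nonneg _)
  have hblock : ∀ β : Pt, ∑ u ∈ B m β, h u ≤ (((n : ℝ) - 1) * ((n : ℝ) ^ 4)⁻¹) *
      ∑ s ∈ B m β, (2 * (PoissonInterior.supNorm (d := 4) (b - s) : ℝ) ^ 2 + 2 * (n : ℝ) ^ 2) * g s := by
    intro β
    calc ∑ u ∈ B m β, h u = ∑ u ∈ B m β, ∑ s ∈ B m β, |toReal (u - b) μ * toReal (u - b) ν| * (|qJet n κ u β s| * g s) := by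
          refine Finset.sum_congr rfl fun u hu => ?_
          rw [hh]; simp only [mem_B.1 hu, Finset.mul_sum]
      _ = ∑ s ∈ B m β, ∑ u ∈ B m β, |toReal (u - b) μ * toReal (u - b) ν| * (|qJet n κ u β s| * g s) := Finset.sum_comm
      _ ≤ ∑ s ∈ B m β, ∑ u ∈ B m β, (2 * (PoissonInterior.supNorm (d := 4) (b - s) : ℝ) ^ 2 + 2 * (n : ℝ) ^ 2) * (|qJet n κ u β s| * g s) :=
          Finset.sum_le_sum fun s hs => Finset.sum_le_sum fun u hu =>
            mul_le_mul_of_nonneg_right (abs_weight_le_of_same_block β u s b hu hs μ ν) (mul_nonneg (abs_nonneg _) (hg0 s))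
      _ = ∑ s ∈ B m β, (2 * (PoissonInterior.supNorm (d := 4) (b - s) : ℝ) ^ 2 + 2 * (n : ℝ) ^ 2) * g s * ∑ u ∈ B m β, |qJet n κ u β s| := by
          refine Finset.sum_congr rfl fun s _ => ?_
          rw [Finset.mul_sum]; exact Finset.sum_congr rfl fun u _ => by ring
      _ ≤ ∑ s ∈ B m β, (2 * (PoissonInterior.supNorm (d := 4) (b - s) : ℝ) ^ 2 + 2 * (n : ℝ) ^ 2) * g s * (((n : ℝ) - 1) * ((n : ℝ) ^ 4)⁻¹) :=
          Finset.sum_le_sum fun s _ => mul_le_mul_of_nonneg_left (NeedleBondMarginal.sum_bond_abs_qJet_le n κ _ β s)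
            (mul_nonneg (by positivity) (hg0 s))
      _ = _ := by rw [Finset.mul_sum]; exact Finset.sum_congr rfl fun s _ => by ring
  have hfin : ∀ S : Finset Pt, ∑ w ∈ S, |toReal w μ * toReal w ν * T w| ≤ (((n : ℝ) - 1) * ((n : ℝ) ^ 4)⁻¹) * Mg := by
    intro S
    set S' : Finset Pt := S.map (addLeftEmbedding b) with hS'
    have hmn : 0 ≤ ((n : ℝ) - 1) * ((n : ℝ) ^ 4)⁻¹ := mul_nonneg (sub_nonneg.2 hn1) (by positivity)
    calc ∑ w ∈ S, |toReal w μ * toReal w ν * T w|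
        ≤ ∑ w ∈ S, h (b + w) := Finset.sum_le_sum fun w _ => hdom w
      _ = ∑ u ∈ S', h u := by rw [hS', Finset.sum_map]; rfl
      _ ≤ ∑ u ∈ U m (S'.image (blk m)), h u := Finset.sum_le_sum_of_subset_of_nonneg (subset_U_image m S') fun u _ _ => hh0 u
      _ = ∑ β ∈ S'.image (blk m), ∑ u ∈ B m β, h u := sum_U _ _
      _ ≤ ∑ β ∈ S'.image (blk m), (((n : ℝ) - 1) * ((n : ℝ) ^ 4)⁻¹) *
            ∑ s ∈ B m β, (2 * (PoissonInterior.supNorm (d := 4) (b - s) : ℝ) ^ 2 + 2 * (n : ℝ) ^ 2) * g s := Finset.sum_le_sum fun β _ => hblock β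
      _ = (((n : ℝ) - 1) * ((n : ℝ) ^ 4)⁻¹) * ∑ s ∈ U m (S'.image (blk m)), (2 * (PoissonInterior.supNorm (d := 4) (b - s) : ℝ) ^ 2 + 2 * (n : ℝ) ^ 2) * g s := by
          rw [← Finset.mul_sum, sum_U]
      _ ≤ (((n : ℝ) - 1) * ((n : ℝ) ^ 4)⁻¹) * Mg := mul_le_mul_of_nonneg_left (hmom _) hmn
  exact (abs_fullSum_le_of_abs_sum_le hfin).2

/-! ## §2 The cell: the envelope's n-powers against the moments and the ray weight -/

variable {n} in
/-- [folklore] the two centred weighted moments at rate `δ∕4`: `Σ (2‖b−s‖²+2n²)·e₄∕nrm ≤ m₁·n⁵`, `Σ (2‖b−s‖²+2n²)·e₄ ≤ m₀·n⁶`. -/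
theorem moments_le {δ : ℝ} (hδ : 0 < δ) (b : Pt) (S : Finset Pt) :
    (∑ s ∈ S, (2 * (PoissonInterior.supNorm (d := 4) (b - s) : ℝ) ^ 2 + 2 * (n : ℝ) ^ 2) *
        (Real.exp (-(δ / 4 / n) * PoissonInterior.supNorm (d := 4) (b - s)) / nrm (b - s) ^ 1)
      ≤ (2 * (2 * (Nat.factorial 2) * (2 / (δ / 4)) ^ 2 * (1 + 2 * (4 : ℕ) * 3 ^ (4 - 1) * ((Nat.factorial (4 - 1 - 1)) * (4 / (δ / 4)) ^ (4 - 1 - 1) * (1 + 4 / (δ / 4)))))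
          + 2 * (2 * (Nat.factorial 0) * (2 / (δ / 4)) ^ 0 * (1 + 2 * (4 : ℕ) * 3 ^ (4 - 1) * ((Nat.factorial (4 - 1 - 1)) * (4 / (δ / 4)) ^ (4 - 1 - 1) * (1 + 4 / (δ / 4))))))
        * (n : ℝ) ^ 5)
    ∧ (∑ s ∈ S, (2 * (PoissonInterior.supNorm (d := 4) (b - s) : ℝ) ^ 2 + 2 * (n : ℝ) ^ 2) *
        (Real.exp (-(δ / 4 / n) * PoissonInterior.supNorm (d := 4) (b - s)) / nrm (b - s) ^ 0)
      ≤ (2 * (2 * (Nat.factorial 2) * (2 / (δ / 4)) ^ 2 * (1 + 2 * (4 : ℕ) * 3 ^ (4 - 1) * ((Nat.factorial (4 - 1 - 0)) * (4 / (δ / 4)) ^ (4 - 1 - 0) * (1 + 4 / (δ / 4)))))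
          + 2 * (2 * (Nat.factorial 0) * (2 / (δ / 4)) ^ 0 * (1 + 2 * (4 : ℕ) * 3 ^ (4 - 1) * ((Nat.factorial (4 - 1 - 0)) * (4 / (δ / 4)) ^ (4 - 1 - 0) * (1 + 4 / (δ / 4))))))
        * (n : ℝ) ^ 6) := by
  have h1 := sum_moment_prof_le (n := n) (ε := δ / 4) (by positivity) (p := 1) (by norm_num) b S
  have h0 := sum_moment_prof_le (n := n) (ε := δ / 4) (by positivity) (p := 0) (by norm_num) b S
  refine ⟨h1.trans (le_of_eq ?_), h0.trans (le_of_eq ?_)⟩ <;> ring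

variable {n} in
/-- [folklore] **«GN-33 ∕ NK»: THE `ndlPiece ⊗ dipPiece` CELL OF T₃ IS n-UNIFORM UNDER THE RAY WEIGHT** — the hypothesis `hnd` of
`GluonNeedleGlue.h₃_of_cells` (there for `n ≥ 2`, a fortiori), modulo [B5, Prop. 1.2] ∧ [B5, (1.126)–(1.127)] BY NAME and the displayed ray pins
`|cK n| ≤ cgh·n²` (the `dip` weight of the ray `SbRc`) and `|cQ n| ≤ cQ₀` (P13): one `C ≥ 0` (depending on `a`, `cgh`, `cQ₀`) with
`|cK n · cellSum n a (ndlPiece n a (cQ n)) (dipPiece n a) μ ν| ≤ C` for every `n ≥ 1`. -/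
theorem exists_ndlDip_row_le (ha : 0 < a) (h12 : B5.Prop12Printed (fam nOf hn1 MOf a ha)) (h126 : B5.Kernel126_127Printed (kfam nOf MOf))
    {cK : ℕ → ℝ} {cgh : ℝ} (hcK : ∀ n, |cK n| ≤ cgh * (n : ℝ) ^ 2) {cQ : ℕ → ℝ} {cQ₀ : ℝ} (hcQ : ∀ n, |cQ n| ≤ cQ₀) (μ ν : Fin 4) :
    ∃ C : ℝ, 0 ≤ C ∧ ∀ (n : ℕ) [NeZero n], |cK n * cellSum n a (ndlPiece n a (cQ n)) (dipPiece n a) μ ν| ≤ C := by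
  obtain ⟨δ, A₁, A₀, hδ, hA₁, hA₀, henv⟩ := exists_word_envelope a ha h12 h126 cQ₀
  have hcgh : 0 ≤ cgh := by have h := hcK 1; norm_num at h; exact (abs_nonneg _).trans h
  set m₁ : ℝ := 2 * (2 * (Nat.factorial 2) * (2 / (δ / 4)) ^ 2 * (1 + 2 * (4 : ℕ) * 3 ^ (4 - 1) * ((Nat.factorial (4 - 1 - 1)) * (4 / (δ / 4)) ^ (4 - 1 - 1) * (1 + 4 / (δ / 4)))))
      + 2 * (2 * (Nat.factorial 0) * (2 / (δ / 4)) ^ 0 * (1 + 2 * (4 : ℕ) * 3 ^ (4 - 1) * ((Nat.factorial (4 - 1 - 1)) * (4 / (δ / 4)) ^ (4 - 1 - 1) * (1 + 4 / (δ / 4))))) with hm₁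
  set m₀ : ℝ := 2 * (2 * (Nat.factorial 2) * (2 / (δ / 4)) ^ 2 * (1 + 2 * (4 : ℕ) * 3 ^ (4 - 1) * ((Nat.factorial (4 - 1 - 0)) * (4 / (δ / 4)) ^ (4 - 1 - 0) * (1 + 4 / (δ / 4)))))
      + 2 * (2 * (Nat.factorial 0) * (2 / (δ / 4)) ^ 0 * (1 + 2 * (4 : ℕ) * 3 ^ (4 - 1) * ((Nat.factorial (4 - 1 - 0)) * (4 / (δ / 4)) ^ (4 - 1 - 0) * (1 + 4 / (δ / 4))))) with hm₀
  have hm₁0 : 0 ≤ m₁ := by positivity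
  have hm₀0 : 0 ≤ m₀ := by positivity
  refine ⟨cgh * (A₁ * m₁ + A₀ * m₀), by positivity, fun n _ => ?_⟩
  clear_value m₁ m₀
  have hn : (0 : ℝ) < n := by exact_mod_cast Nat.pos_of_ne_zero (NeZero.ne n)
  have hn1 : (1 : ℝ) ≤ n := by exact_mod_cast NeZero.one_le
  -- the site envelope at this n, read at the base `b`
  set g : Pt → Pt → ℝ := fun b s => A₁ * ((n : ℝ) ^ 4)⁻¹ * (Real.exp (-(δ / 4 / n) * PoissonInterior.supNorm (d := 4) (b - s)) / nrm (b - s) ^ 1)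
    + A₀ * ((n : ℝ) ^ 5)⁻¹ * (Real.exp (-(δ / 4 / n) * PoissonInterior.supNorm (d := 4) (b - s)) / nrm (b - s) ^ 0) with hg
  have hg0 : ∀ b s, 0 ≤ g b s := fun b s => by
    have := nrm_pos (b - s); simp only [hg]; positivity
  have hT : ∀ b w : Pt, |biBubbleTable (Ga n a) (Ga n a) (ndlPiece n a (cQ n)) (dipPiece n a) μ ν (b + w) b|
      ≤ ∑ s ∈ B (n - 1) (blk (n - 1) (b + w)), |qJet n μ (b + w) (blk (n - 1) (b + w)) s| * g b s := by
    intro b w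
    refine (henv n (cQ n) (hcQ n) μ ν (b + w) b).trans (le_of_eq (Finset.sum_congr rfl fun s _ => ?_))
    have e : PoissonInterior.supNorm (d := 4) (s - b) = PoissonInterior.supNorm (d := 4) (b - s) ∧ nrm (s - b) = nrm (b - s) := by
      rw [show s - b = -(b - s) by abel, PoissonInterior.supNorm_neg, nrm_neg]; exact ⟨rfl, rfl⟩
    simp only [hg, e.1, e.2, pow_one, pow_zero, div_one]
  have hmom : ∀ (b : Pt) (S : Finset Pt), ∑ s ∈ S, (2 * (PoissonInterior.supNorm (d := 4) (b - s) : ℝ) ^ 2 + 2 * (n : ℝ) ^ 2) * g b s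
      ≤ A₁ * ((n : ℝ) ^ 4)⁻¹ * (m₁ * (n : ℝ) ^ 5) + A₀ * ((n : ℝ) ^ 5)⁻¹ * (m₀ * (n : ℝ) ^ 6) := by
    intro b S
    obtain ⟨h1, h0⟩ := moments_le (n := n) hδ b S
    rw [← hm₁] at h1; rw [← hm₀] at h0
    calc ∑ s ∈ S, (2 * (PoissonInterior.supNorm (d := 4) (b - s) : ℝ) ^ 2 + 2 * (n : ℝ) ^ 2) * g b s
        = A₁ * ((n : ℝ) ^ 4)⁻¹ * ∑ s ∈ S, (2 * (PoissonInterior.supNorm (d := 4) (b - s) : ℝ) ^ 2 + 2 * (n : ℝ) ^ 2) *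
              (Real.exp (-(δ / 4 / n) * PoissonInterior.supNorm (d := 4) (b - s)) / nrm (b - s) ^ 1)
          + A₀ * ((n : ℝ) ^ 5)⁻¹ * ∑ s ∈ S, (2 * (PoissonInterior.supNorm (d := 4) (b - s) : ℝ) ^ 2 + 2 * (n : ℝ) ^ 2) *
              (Real.exp (-(δ / 4 / n) * PoissonInterior.supNorm (d := 4) (b - s)) / nrm (b - s) ^ 0) := by
          rw [Finset.mul_sum, Finset.mul_sum, ← Finset.sum_add_distrib]
          exact Finset.sum_congr rfl fun s _ => by simp only [hg]; ring
      _ ≤ _ := add_le_add (mul_le_mul_of_nonneg_left h1 (by positivity)) (mul_le_mul_of_nonneg_left h0 (by positivity))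
  -- one base site, uniformly
  have hsite : ∀ b : Pt, |fullSum (fun w : Pt => toReal w μ * toReal w ν *
      biBubbleTable (Ga n a) (Ga n a) (ndlPiece n a (cQ n)) (dipPiece n a) μ ν (b + w) b)| ≤ ((n : ℝ) ^ 2)⁻¹ * (A₁ * m₁ + A₀ * m₀) := by
    intro b
    refine (abs_fullSum_le_of_needle_envelope n μ b (hg0 b) (hT b) (hmom b) μ ν).trans ?_
    have e : (((n : ℝ) - 1) * ((n : ℝ) ^ 4)⁻¹) * (A₁ * ((n : ℝ) ^ 4)⁻¹ * (m₁ * (n : ℝ) ^ 5) + A₀ * ((n : ℝ) ^ 5)⁻¹ * (m₀ * (n : ℝ) ^ 6))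
        = (((n : ℝ) - 1) / n) * (((n : ℝ) ^ 2)⁻¹ * (A₁ * m₁ + A₀ * m₀)) := by field_simp
    rw [e]
    exact mul_le_of_le_one_left (by positivity) ((div_le_one hn).2 (by linarith))
  -- the base average is convex, then the ray weight
  rw [cellSum_def, abs_mul]
  calc |cK n| * |∑ b ∈ (univ : Finset (Fin 4 → Fin n)).image resSite, ((n : ℝ) ^ 4)⁻¹ *
          fullSum (fun w : Pt => toReal w μ * toReal w ν * biBubbleTable (Ga n a) (Ga n a) (ndlPiece n a (cQ n)) (dipPiece n a) μ ν (b + w) b)|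
      ≤ (cgh * (n : ℝ) ^ 2) * ∑ b ∈ (univ : Finset (Fin 4 → Fin n)).image resSite, ((n : ℝ) ^ 4)⁻¹ * (((n : ℝ) ^ 2)⁻¹ * (A₁ * m₁ + A₀ * m₀)) := by
        refine mul_le_mul (hcK n) ((Finset.abs_sum_le_sum_abs _ _).trans (Finset.sum_le_sum fun b _ => ?_)) (abs_nonneg _) (by positivity)
        rw [abs_mul, abs_of_nonneg (by positivity : (0 : ℝ) ≤ ((n : ℝ) ^ 4)⁻¹)]
        exact mul_le_mul_of_nonneg_left (hsite b) (by positivity)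
    _ ≤ (cgh * (n : ℝ) ^ 2) * (((n : ℝ) ^ 2)⁻¹ * (A₁ * m₁ + A₀ * m₀)) :=
        mul_le_mul_of_nonneg_left (sum_resSite_avg_le (by positivity)) (by positivity)
    _ = cgh * (A₁ * m₁ + A₀ * m₀) := by field_simp

/-! ## §3 (v1.1, APPENDED 2026-08-21 for the owner's «GN-WIRE» `GluonNeedleRowT3.h₃_of_prop12'`) The cell in the displayed auxiliary-weight form -/

variable {n} in
/-- [folklore] **`hNK` OF `GluonNeedleRowT3.h₃_of_prop12'` IN ITS DISPLAYED SHAPE** — the cell at the auxiliary constant weight `cgh₀·n²` (`0 ≤ cgh₀`), modulo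
[B5, Prop. 1.2] ∧ [B5, (1.126)–(1.127)] BY NAME and `|cQ n| ≤ cQ₀`: `∃ C ≥ 0, ∀ n [NeZero n], |cgh₀·n²·cellSum n a (ndlPiece n a (cQ n)) (dipPiece n a) μ ν| ≤ C`
(`exists_ndlDip_row_le` at `cK n := cgh₀·n²`, `cgh := cgh₀`). -/
theorem hNK_of_prop12 (ha : 0 < a) (h12 : B5.Prop12Printed (fam nOf hn1 MOf a ha)) (h126 : B5.Kernel126_127Printed (kfam nOf MOf))
    {cgh₀ : ℝ} (hcgh₀ : 0 ≤ cgh₀) {cQ : ℕ → ℝ} {cQ₀ : ℝ} (hcQ : ∀ n, |cQ n| ≤ cQ₀) (μ ν : Fin 4) :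
    ∃ C : ℝ, 0 ≤ C ∧ ∀ (n : ℕ) [NeZero n], |cgh₀ * (n : ℝ) ^ 2 * cellSum n a (ndlPiece n a (cQ n)) (dipPiece n a) μ ν| ≤ C :=
  exists_ndlDip_row_le a ha h12 h126 (cK := fun n => cgh₀ * (n : ℝ) ^ 2) (cgh := cgh₀)
    (fun n => by rw [abs_mul, abs_of_nonneg hcgh₀, abs_pow, Nat.abs_cast]) hcQ μ ν

end Summit.QuantumFields.BalabanUV.Beta.D1BFx.NeedleNdlDipRow

end
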